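import Mathlib
import Summits.NavierStokesRegularity.NavierStokesRegularity.Theorems.FilamentSkeletonRssSelectionBoxRJRungChiZero
import Summits.NavierStokesRegularity.NavierStokesRegularity.Theorems.FilamentSkeletonRssSelectionBoxRJRungCutoffDeriv
import Summits.NavierStokesRegularity.NavierStokesRegularity.Theorems.FilamentSkeletonRssSelectionBoxRJRungSelfScaling
import Summits.NavierStokesRegularity.NavierStokesRegularity.Theorems.FilamentSkeletonRssSelectionBoxRJRungArcModulus
import Summits.NavierStokesRegularity.NavierStokesRegularity.Theorems.FilamentSkeletonRssSelectionBoxRJRungDefectConstants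
import Summits.NavierStokesRegularity.NavierStokesRegularity.Theorems.FilamentSkeletonRssSelectionBoxRJRungLiaReduction

/-!
# Route `FilamentSkeletonRss` · crux `SelectionBoxRJ` (stmt-NavierStokesRegularity-21220) — RUNG 3⁻ (a posteriori):
# with the PHYSICAL local-induction coefficient, the R2 arc is tangent to the FULL true skeleton velocity up to `√Γ/60`

Lane `ns-filament-19175-p1` (g7); helper file `--supports stmt-NavierStokesRegularity-21220`, route-independent.

THE STEP.  Rungs 1–2 model the self-induction of the filament by the cut-off local-induction term `η⁻¹ x′×x″` with a free
coefficient `0 < η ≤ 7/(Γ log Γ)`.  Here `η` is FIXED to the physical value `η = ((Γ·4/(4π))·Λ)⁻¹`,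
`Λ = arsinh(δ√Γ) − δ√Γ/√(δ²Γ + 1)` (`δ = e⁻²/2` waists) — the leading coefficient of the regularised Biot–Savart
self-field of a filament of circulation `4Γ` (`…RungLiaReduction.nearStraight_liaReduction`, in waist units via
`…RungSelfScaling`) — which is admissible (`ηΓ log Γ ≤ 7`, `…RungDefectConstants`), and the R2 arc built with the `C¹`
cut-off of `…RungCutoffDeriv` (`truePartnerArc_zero_chi`) is shown to satisfy, on the tangency ball
`‖x t‖ ≤ Rb√(Γ log Γ)`,

`‖ V(x t) + f(t) + (Γ·4/(4π)) ∫ ((‖x t − x σ‖²+1)^{3/2})⁻¹ • x′σ × (x t − x σ) dσ − w(t) x′(t) ‖ ≤ √Γ/60`,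

i.e. the FULL true skeleton velocity of the box (`u p Z (Z j τ)` with BOTH the self term `k = j` and the partner term, true
regularised kernel) is tangent along the arc up to a defect `≤ √Γ/60`, to be compared with the slip scale (`w` ranges over
`≍ √Γ/10` across the stagnation window).  Ingredients: `cutoff_bending_le`/`cutoff_modulus` (waist-unit curvature
`≤ 1/4000`, `C^{2,1}` modulus `≤ 1/140`), `defect_rem` (LIA remainder `≤ 1/20` in waist units), and the exact algebra
`η⁻¹ x′×x″ = (Γ·4/(4π))·Λ·x′×x″`.

HONEST FRAMING.  This is an A-POSTERIORI defect estimate for a HYPOTHETICAL filament box, not exact tangency with the true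
kernel (that is R3: a fixed point absorbing the defect, which needs the remainder's Lipschitz dependence on the curve); NOT an
instance of `SelectionBoxRJ`; constants unoptimised (`Rb ≤ 1/500`, `log Γ ≥ Rb⁻²`); nothing here is a claim about
Navier–Stokes regularity or blow-up.
-/

set_option linter.dupNamespace false -- `Theorems.…Theorems`-style path/namespace repetition is the tree convention

noncomputable section

namespace Summit.NavierStokesRegularity.NavierStokesRegularity.Theorems

open Set Function Filter MeasureTheory Real Metric
open Literature.Analysis.FluidPDE
open scoped InnerProductSpace Topology

namespace SelectionBoxRJRung

/-- Near-straight chord–arc from an arbitrary base point: `‖x′ − e‖ ≤ θ`, `‖e‖ = 1` ⇒ `(1 − θ)|u − v| ≤ ‖x u − x v‖`.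
[folklore] -/
theorem nearStraight_chordArc {θ : ℝ} {x : ℝ → EuclideanSpace ℝ (Fin 3)} {e : EuclideanSpace ℝ (Fin 3)}
    (hxd : Differentiable ℝ x) (he : ‖e‖ = 1) (hθ : ∀ s, ‖deriv x s - e‖ ≤ θ) (u v : ℝ) :
    (1 - θ) * |u - v| ≤ ‖x u - x v‖ := by
  have hg : ∀ s, HasDerivAt (fun s => x s - s • e) (deriv x s - e) s := fun s => by
    have h1 := (hxd s).hasDerivAt
    have h2 : HasDerivAt (fun s : ℝ => s • e) ((1:ℝ) • e) s := (hasDerivAt_id s).smul_const e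
    have h3 : HasDerivAt (fun s => x s - s • e) (deriv x s - (1:ℝ) • e) s := h1.sub h2
    rwa [one_smul] at h3
  have h := Convex.norm_image_sub_le_of_norm_deriv_le (f := fun s => x s - s • e)
    (fun s _ => (hg s).differentiableAt) (fun s _ => by rw [(hg s).deriv]; exact hθ s) convex_univ (mem_univ v) (mem_univ u)
  have hsplit : x u - x v = (u - v) • e + ((x u - u • e) - (x v - v • e)) := by rw [sub_smul]; abel
  have hn : ‖(u - v) • e‖ = |u - v| := by rw [norm_smul, Real.norm_eq_abs, he, mul_one]
  rw [Real.norm_eq_abs] at h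
  calc (1 - θ) * |u - v| = |u - v| - θ * |u - v| := by ring
    _ ≤ ‖(u - v) • e‖ - ‖(x u - u • e) - (x v - v • e)‖ := by rw [hn]; linarith
    _ ≤ ‖x u - x v‖ := by rw [hsplit]; exact norm_sub_le_norm_add _ _

/-- **RUNG 3⁻ (a-posteriori true-kernel tangency).**  See the module docstring. [folklore] -/
theorem trueKernel_defect_rung {Γ Rb : ℝ} (hRb0 : 0 < Rb) (hRb : Rb ≤ 1 / 500) (hΓ : Real.exp (1 / Rb ^ 2) ≤ Γ) :
    ∃ (η : ℝ) (x : ℝ → EuclideanSpace ℝ (Fin 3)) (f : ℝ → EuclideanSpace ℝ (Fin 3)) (w : ℝ → ℝ) (c₀ : ℝ),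
      -- the PHYSICAL local-induction coefficient
      (η = (Γ * 4 / (4 * Real.pi) * (Real.arsinh (Real.exp (-2) / 2 / (Real.sqrt Γ)⁻¹) -
          Real.exp (-2) / 2 / Real.sqrt ((Real.exp (-2) / 2) ^ 2 + ((Real.sqrt Γ)⁻¹) ^ 2)))⁻¹ ∧
        0 < η ∧ η * (Γ * Real.log Γ) ≤ 7) ∧
      -- the TRUE partner forcing along `x` and the nonlocal cut-off local-induction equation
      ((∀ t, f t = (Γ * 4 / (4 * Real.pi)) • ∫ σ : ℝ,
          ((‖x t - ((2 * ⟪x σ, EuclideanSpace.single 2 1⟫_ℝ) • (EuclideanSpace.single (2 : Fin 3) (1 : ℝ)) - x σ)‖ ^ 2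
              + 1) ^ (3 / 2 : ℝ))⁻¹ •
            cross (deriv (fun u => (2 * ⟪x u, EuclideanSpace.single 2 1⟫_ℝ) •
                (EuclideanSpace.single (2 : Fin 3) (1 : ℝ)) - x u) σ)
              (x t - ((2 * ⟪x σ, EuclideanSpace.single 2 1⟫_ℝ) • (EuclideanSpace.single (2 : Fin 3) (1 : ℝ)) - x σ))) ∧
        ContDiff ℝ 2 x ∧ x 0 = WithLp.toLp 2 ![Real.sqrt Γ / 5, 0, 0] ∧
        deriv x 0 = WithLp.toLp 2 ![0, (Real.sqrt 2)⁻¹, (Real.sqrt 2)⁻¹] ∧ (∀ t, ‖deriv x t‖ = 1) ∧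
        (∀ t, ‖deriv x t - WithLp.toLp 2 ![0, (Real.sqrt 2)⁻¹, (Real.sqrt 2)⁻¹]‖ ≤ 1 / 3000) ∧
        (∀ t, ‖iteratedDeriv 2 x t‖ * Real.sqrt Γ ≤ 1) ∧
        (∀ t, 6 / 5 * (Rb * Real.sqrt (Γ * Real.log Γ)) ≤ |t| → iteratedDeriv 2 x t = 0)) ∧
      -- radial growth, properness, chord–arc, separation from the partner `R_π ∘ x` (clause 3)
      ((∀ t, 2999 / 3000 * |t| ≤ ‖x t‖) ∧ Tendsto (fun t => ‖x t‖) (cocompact ℝ) atTop ∧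
        (∀ τ σ, 1 / 2 * |τ - σ| ≤ ‖x τ - x σ‖) ∧
        (∀ τ σ, 39 / 100 * Real.sqrt Γ ≤
          ‖x τ - ((2 * ⟪x σ, EuclideanSpace.single 2 1⟫_ℝ) • (EuclideanSpace.single (2 : Fin 3) (1 : ℝ)) - x σ)‖)) ∧
      -- the slip, MODEL tangency on the ball, the unique supercritical-side zero (clauses 9, 10, 11)
      ((∀ t, w t = ⟪deriv x t,
          ((1 / 2 : ℝ) • x t - (21 / 5 : ℝ) • cross (EuclideanSpace.single 2 1) (x t)) + f t⟫_ℝ) ∧ Differentiable ℝ w ∧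
        (∀ t, ‖x t‖ ≤ Rb * Real.sqrt (Γ * Real.log Γ) →
          ((1 / 2 : ℝ) • x t - (21 / 5 : ℝ) • cross (EuclideanSpace.single 2 1) (x t)) + f t +
              η⁻¹ • cross (deriv x t) (iteratedDeriv 2 x t) = w t • deriv x t) ∧
        w c₀ = 0 ∧ (∀ τ, w τ = 0 → τ = c₀) ∧ -(9 / 20) * Real.sqrt Γ < c₀ ∧ c₀ < -(7 / 20) * Real.sqrt Γ ∧
        ‖x c₀‖ ≤ 1 / 2 * Real.sqrt Γ ∧ |⟪deriv x c₀, EuclideanSpace.single 2 1⟫_ℝ| ≤ 1 - 1 / 5 ∧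
        StrictMonoOn w (Iic 0) ∧ 8 / 5 ≤ deriv w c₀ ∧ deriv w c₀ ≤ 7 / 2 ∧ (∀ t, 0 ≤ t → 0 < w t)) ∧
      -- RUNG 3⁻: the FULL true skeleton velocity (self-induction with the true regularised kernel + true partner + drift)
      -- is tangent on the ball up to `√Γ/60`
      (∀ t, ‖x t‖ ≤ Rb * Real.sqrt (Γ * Real.log Γ) →
        ‖((1 / 2 : ℝ) • x t - (21 / 5 : ℝ) • cross (EuclideanSpace.single 2 1) (x t)) + f t +
            (Γ * 4 / (4 * Real.pi)) • (∫ σ : ℝ, ((‖x t - x σ‖ ^ 2 + 1) ^ (3 / 2 : ℝ))⁻¹ • cross (deriv x σ) (x t - x σ)) -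
            w t • deriv x t‖ ≤ Real.sqrt Γ / 60) := by
  -- the coefficient and its constants
  obtain ⟨Λ, hΛ⟩ : ∃ Λ : ℝ, Λ = Real.arsinh (Real.exp (-2) / 2 / (Real.sqrt Γ)⁻¹) -
      Real.exp (-2) / 2 / Real.sqrt ((Real.exp (-2) / 2) ^ 2 + ((Real.sqrt Γ)⁻¹) ^ 2) := ⟨_, rfl⟩
  obtain ⟨η, hη⟩ : ∃ η : ℝ, η = (Γ * 4 / (4 * Real.pi) * Λ)⁻¹ := ⟨_, rfl⟩
  obtain ⟨hΓ4, hΛ0, hη0, hηL, hκt, hHt⟩ := defect_constants hRb0 hRb hΓ hΛ hη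
  have hΓ0 : 0 < Γ := by linarith [show (0:ℝ) < 10 ^ 4 by norm_num]
  have hG : 0 < Real.sqrt Γ := Real.sqrt_pos.2 hΓ0
  have hπ := Real.pi_gt_three
  have hcΓ : 0 < Γ * 4 / (4 * Real.pi) := by positivity
  -- the cut-off with derivative bound
  obtain ⟨S, hS⟩ : ∃ S : ℝ, S = Rb * Real.sqrt (Γ * Real.log Γ) := ⟨_, rfl⟩
  have hlog : 0 < Real.log Γ := Real.log_pos (by linarith)
  have hS0 : 0 < S := by rw [hS]; exact mul_pos hRb0 (Real.sqrt_pos.2 (mul_pos hΓ0 hlog))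
  obtain ⟨χ, hχs, hχ1, hχ0, hχnn, hχle, hχd⟩ :=
    exists_cutoff_deriv (S₁ := 11 / 10 * S) (S₂ := 6 / 5 * S) (by linarith)
  rw [hS] at hχ1 hχ0 hχd
  -- the χ-parametric R2 package with this `η`
  obtain ⟨x, f, w, c₀, ⟨hf, hxc, hx0, hx0', hxu, hxode⟩, ⟨hnear, hcurv, harm⟩, h3, ⟨hw, -, htan⟩,
    ⟨-, -, hc₀, hc1, hc2, hwaist, htilt, hposR⟩, ⟨hfd', hwd, hmono, huniq, hsl1, hsl2⟩⟩ :=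
    truePartnerArc_zero_chi hRb0 hRb hΓ hη0 hηL χ hχs.continuous hχ1 hχ0 (fun t => ⟨hχnn t, hχle t⟩)
  refine ⟨η, x, f, w, c₀, ⟨by rw [hη, hΛ], hη0, hηL⟩, ⟨hf, hxc, hx0, hx0', hxu, hnear, hcurv, harm⟩, h3,
    ⟨hw, hwd, htan, hc₀, huniq, hc1, hc2, hwaist, htilt, hmono, hsl1, hsl2, hposR⟩, fun t ht => ?_⟩
  /- ===== the defect at `t` ===== -/
  have hxd : Differentiable ℝ x := hxc.differentiable (by norm_num)
  have hx1 : ContDiff ℝ 1 x := hxc.of_le (by norm_num)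
  have h2 : iteratedDeriv 2 x = deriv (deriv x) := by rw [iteratedDeriv_succ, iteratedDeriv_one]
  have hG0 : Real.sqrt Γ ≠ 0 := hG.ne'
  have hG2 : Real.sqrt Γ ^ 2 = Γ := Real.sq_sqrt hΓ0.le
  -- (1) algebra: the defect vector is `cΓ • (S₁ − Λ • x′×x″)`
  have hηinv : η⁻¹ = Γ * 4 / (4 * Real.pi) * Λ := by rw [hη, inv_inv]
  have htan_t := htan t ht
  rw [h2, hηinv] at htan_t
  have hid : ((1 / 2 : ℝ) • x t - (21 / 5 : ℝ) • cross (EuclideanSpace.single 2 1) (x t)) + f t +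
      (Γ * 4 / (4 * Real.pi)) • (∫ σ : ℝ, ((‖x t - x σ‖ ^ 2 + 1) ^ (3 / 2 : ℝ))⁻¹ • cross (deriv x σ) (x t - x σ)) -
      w t • deriv x t =
      (Γ * 4 / (4 * Real.pi)) • ((∫ σ : ℝ, ((‖x t - x σ‖ ^ 2 + 1) ^ (3 / 2 : ℝ))⁻¹ • cross (deriv x σ) (x t - x σ)) -
        Λ • cross (deriv x t) (deriv (deriv x) t)) := by
    rw [← htan_t, smul_sub, smul_smul]; abel
  rw [hid, norm_smul, Real.norm_eq_abs, abs_of_pos hcΓ]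
  -- (2) the rescaled (waist-unit) curve
  obtain ⟨X, hX⟩ : ∃ X : ℝ → EuclideanSpace ℝ (Fin 3), X = fun s : ℝ => (Real.sqrt Γ)⁻¹ • x (Real.sqrt Γ * s) :=
    ⟨_, rfl⟩
  have hXc : ContDiff ℝ 2 X := by rw [hX]; exact rescale_contDiff hxc _
  have hXd1 : deriv X = fun s => deriv x (Real.sqrt Γ * s) := by rw [hX]; exact rescale_deriv hxd hG0
  have hXd2 : ∀ s, deriv (deriv X) s = Real.sqrt Γ • deriv (deriv x) (Real.sqrt Γ * s) := fun s => by
    rw [hX]; exact rescale_deriv2 hxc hG0 s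
  have hS₁ := selfInduction_rescale hxd hG X hX t
  have hGt : Real.sqrt Γ * (t / Real.sqrt Γ) = t := mul_div_cancel₀ t hG0
  have hcross : Λ • cross (deriv x t) (deriv (deriv x) t) =
      (Real.sqrt Γ)⁻¹ • (Λ • cross (deriv X (t / Real.sqrt Γ)) (deriv (deriv X) (t / Real.sqrt Γ))) := by
    rw [hXd2, hXd1]; dsimp only; rw [hGt, ← crossCLM_apply (deriv x t) (Real.sqrt Γ • _), map_smul, crossCLM_apply,
      smul_smul, smul_smul, show (Real.sqrt Γ)⁻¹ * Λ * Real.sqrt Γ = Λ by field_simp]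
  rw [hS₁, hcross, ← smul_sub, norm_smul, Real.norm_eq_abs, abs_of_pos (inv_pos.2 hG)]
  -- (3) hypotheses of the quantitative local-induction lemma for `X`
  have e_def : ∀ s, ‖deriv X s‖ = 1 := fun s => by rw [hXd1]; exact hxu _
  -- partner forcing: size and Lipschitz constant
  set U : ℝ → EuclideanSpace ℝ (Fin 3) := fun t => (2 * Γ / Real.pi / (4 * Γ / 25 + 1 + t ^ 2)) •
      ((2 * Real.sqrt Γ / 5) • (WithLp.toLp 2 ![0, (Real.sqrt 2)⁻¹, (Real.sqrt 2)⁻¹] : EuclideanSpace ℝ (Fin 3)) -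
        t • WithLp.toLp 2 ![(1:ℝ), 0, 0]) with hUdef
  have hU : ∀ t, U t = (2 * Γ / Real.pi / (4 * Γ / 25 + 1 + t ^ 2)) •
      ((2 * Real.sqrt Γ / 5) • (WithLp.toLp 2 ![0, (Real.sqrt 2)⁻¹, (Real.sqrt 2)⁻¹] : EuclideanSpace ℝ (Fin 3)) -
        t • WithLp.toLp 2 ![(1:ℝ), 0, 0]) := fun t => rfl
  have hfM : ∀ s, |s| ≤ 6 / 5 * (Rb * Real.sqrt (Γ * Real.log Γ)) → ‖f s‖ ≤ 17 / 10 * Real.sqrt Γ := fun s _ => by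
    rw [hf s]; exact partnerForcing_norm_le (θ := 1 / 3000) hΓ0 (by norm_num) (by norm_num) hx1 hxu hx0 hnear s
  obtain ⟨hfd, hf1⟩ := partnerField_deriv_sub_le (θ := 1 / 3000) hΓ0 (by norm_num) (by norm_num) U hU hx1 hxu hx0
    hnear f hf
  have hfL : ∀ u v, ‖f u - f v‖ ≤ (12 + 710 * (1 / 3000)) * |u - v| := by
    intro u v
    have h := Convex.norm_image_sub_le_of_norm_deriv_le (f := f) (C := 12 + 710 * (1 / 3000)) (fun s _ => hfd s)
      (fun s _ => by
      have h1 := hf1 s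
      have h2 := norm_U_deriv_le hΓ0 U hU s
      have h3 := norm_sub_norm_le (deriv f s) (deriv U s)
      linarith only [h1, h2, h3]) convex_univ (mem_univ v) (mem_univ u)
    rw [Real.norm_eq_abs] at h; exact h
  -- the coefficient `c = ηχ`
  have hcb : ∀ s, |η * χ s| ≤ η := fun s => by
    rw [abs_mul, abs_of_pos hη0, abs_of_nonneg (hχnn s)]; nlinarith only [hχle s, hη0]
  have hc0 : ∀ s, 6 / 5 * (Rb * Real.sqrt (Γ * Real.log Γ)) ≤ |s| → η * χ s = 0 := fun s hs => by
    rw [hχ0 s hs, mul_zero]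
  have hD0 : 0 < 3 / (6 / 5 * (Rb * Real.sqrt (Γ * Real.log Γ)) - 11 / 10 * (Rb * Real.sqrt (Γ * Real.log Γ))) := by
    rw [← hS]; exact div_pos (by norm_num) (by linarith only [hS0])
  have hχL : ∀ u v, |χ u - χ v| ≤
      3 / (6 / 5 * (Rb * Real.sqrt (Γ * Real.log Γ)) - 11 / 10 * (Rb * Real.sqrt (Γ * Real.log Γ))) * |u - v| := by
    intro u v
    have h := Convex.norm_image_sub_le_of_norm_deriv_le (f := χ) (fun s _ => (hχs.differentiable one_ne_zero) s)
      (fun s _ => by rw [Real.norm_eq_abs]; exact hχd s) convex_univ (mem_univ v) (mem_univ u)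
    rw [Real.norm_eq_abs, Real.norm_eq_abs] at h; exact h
  have hcL : ∀ u v, |η * χ u - η * χ v| ≤
      η * (3 / (6 / 5 * (Rb * Real.sqrt (Γ * Real.log Γ)) - 11 / 10 * (Rb * Real.sqrt (Γ * Real.log Γ)))) * |u - v| := by
    intro u v
    rw [← mul_sub, abs_mul, abs_of_pos hη0, mul_assoc]
    exact mul_le_mul_of_nonneg_left (hχL u v) hη0.le
  -- curvature and modulus of the box arc
  have hS₂0 : 0 < 6 / 5 * (Rb * Real.sqrt (Γ * Real.log Γ)) := by rw [← hS]; linarith only [hS0]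
  obtain ⟨-, hcurv', -⟩ := cutoff_bending_le (c := fun s => η * χ s) (M := 17 / 10 * Real.sqrt Γ) hη0.le hS₂0
    (by positivity) hxc hxu hxode hcb hc0 hfM
  have hLip := cutoff_modulus (c := fun s => η * χ s) (M := 17 / 10 * Real.sqrt Γ) (M' := 12 + 710 * (1 / 3000))
    hη0.le hS₂0 (by positivity) (by norm_num) (by positivity) hxc hxu hxode hcb hc0 hcL hfM hfL
  rw [hx0, norm_waist Γ hΓ0.le] at hcurv' hLip
  -- the waist-unit data
  obtain ⟨κ, hκ⟩ : ∃ κ : ℝ, κ = Real.sqrt Γ * (η * ((47 / 10) * (Real.sqrt Γ / 5 + 6 / 5 * (Rb * Real.sqrt (Γ * Real.log Γ))) +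
      17 / 10 * Real.sqrt Γ)) := ⟨_, rfl⟩
  obtain ⟨H, hH⟩ : ∃ H : ℝ, H = Γ * (η * (3 / (6 / 5 * (Rb * Real.sqrt (Γ * Real.log Γ)) -
      11 / 10 * (Rb * Real.sqrt (Γ * Real.log Γ)))) *
        ((47 / 10) * (Real.sqrt Γ / 5 + 6 / 5 * (Rb * Real.sqrt (Γ * Real.log Γ))) + 17 / 10 * Real.sqrt Γ) +
      η * (η * ((47 / 10) * (Real.sqrt Γ / 5 + 6 / 5 * (Rb * Real.sqrt (Γ * Real.log Γ))) + 17 / 10 * Real.sqrt Γ) *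
        ((47 / 10) * (Real.sqrt Γ / 5 + 6 / 5 * (Rb * Real.sqrt (Γ * Real.log Γ))) + 17 / 10 * Real.sqrt Γ) +
        (47 / 10 + (12 + 710 * (1 / 3000))))) := ⟨_, rfl⟩
  rw [← hκ] at hκt
  rw [← hH] at hHt
  have hκ0 : 0 ≤ κ := by rw [hκ]; positivity
  have hA0 : 0 ≤ (47 / 10) * (Real.sqrt Γ / 5 + 6 / 5 * (Rb * Real.sqrt (Γ * Real.log Γ))) + 17 / 10 * Real.sqrt Γ := by
    positivity
  have hH0 : 0 ≤ H := by
    rw [hH]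
    exact mul_nonneg hΓ0.le (add_nonneg (mul_nonneg (mul_nonneg hη0.le hD0.le) hA0)
      (mul_nonneg hη0.le (add_nonneg (mul_nonneg (mul_nonneg hη0.le hA0) hA0) (by norm_num))))
  have hXκ : ∀ u, ‖deriv (deriv X) u‖ ≤ κ := fun u => by
    rw [hXd2, norm_smul, Real.norm_eq_abs, abs_of_pos hG, hκ]
    refine mul_le_mul_of_nonneg_left ?_ hG.le
    rw [← congrFun h2]; exact hcurv' _
  have hXH : ∀ u v, ‖deriv (deriv X) u - deriv (deriv X) v‖ ≤ H * |u - v| := by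
    intro u v
    rw [hXd2, hXd2, ← smul_sub, norm_smul, Real.norm_eq_abs, abs_of_pos hG, hH]
    have h := hLip (Real.sqrt Γ * u) (Real.sqrt Γ * v)
    rw [← mul_sub, abs_mul, abs_of_pos hG] at h
    have h' := mul_le_mul_of_nonneg_left h hG.le
    refine h'.trans (le_of_eq ?_)
    have hΓs : Real.sqrt Γ * Real.sqrt Γ = Γ := Real.mul_self_sqrt hΓ0.le
    calc _ = (Real.sqrt Γ * Real.sqrt Γ) * ((η * (3 / (6 / 5 * (Rb * Real.sqrt (Γ * Real.log Γ)) -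
          11 / 10 * (Rb * Real.sqrt (Γ * Real.log Γ)))) *
        ((47 / 10) * (Real.sqrt Γ / 5 + 6 / 5 * (Rb * Real.sqrt (Γ * Real.log Γ))) + 17 / 10 * Real.sqrt Γ) +
        η * (η * ((47 / 10) * (Real.sqrt Γ / 5 + 6 / 5 * (Rb * Real.sqrt (Γ * Real.log Γ))) + 17 / 10 * Real.sqrt Γ) *
          ((47 / 10) * (Real.sqrt Γ / 5 + 6 / 5 * (Rb * Real.sqrt (Γ * Real.log Γ))) + 17 / 10 * Real.sqrt Γ) +
          (47 / 10 + (12 + 710 * (1 / 3000))))) * |u - v|) := by ring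
      _ = _ := by rw [hΓs]; ring
  have hXchord : ∀ u, (1 - 1 / 3000) * |u - t / Real.sqrt Γ| ≤ ‖X u - X (t / Real.sqrt Γ)‖ := by
    intro u
    have h := nearStraight_chordArc (θ := 1 / 3000) hxd norm_tangent₁ hnear (Real.sqrt Γ * u) t
    rw [hX]; dsimp only
    rw [hGt, ← smul_sub, norm_smul, Real.norm_eq_abs, abs_of_pos (inv_pos.2 hG)]
    rw [show Real.sqrt Γ * u - t = Real.sqrt Γ * (u - t / Real.sqrt Γ) by field_simp, abs_mul, abs_of_pos hG] at h
    rw [le_inv_mul_iff₀' hG]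
    calc (1 - 1 / 3000) * |u - t / Real.sqrt Γ| * Real.sqrt Γ = (1 - 1 / 3000) * (Real.sqrt Γ * |u - t / Real.sqrt Γ|) := by
          ring
      _ ≤ _ := h
  have hXnear : ∀ u, ‖deriv X u - WithLp.toLp 2 ![0, (Real.sqrt 2)⁻¹, (Real.sqrt 2)⁻¹]‖ ≤ 1 / 3000 := fun u => by
    rw [hXd1]; exact hnear _
  obtain ⟨hwin, hrem⟩ := defect_rem hκ0 hκt hH0 hHt
  -- (4) the quantitative local-induction lemma in waist units
  obtain ⟨-, hB⟩ := nearStraight_liaReduction (1 - 1 / 3000) H κ (Real.exp (-2) / 2) (1 / 3000) (Real.sqrt Γ)⁻¹ X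
    (WithLp.toLp 2 ![0, (Real.sqrt 2)⁻¹, (Real.sqrt 2)⁻¹]) (t / Real.sqrt Γ) (by norm_num) hH0 hκ0 (by positivity) hwin
    (inv_pos.2 hG) hXc e_def hXκ hXH hXchord (le_of_eq norm_tangent₁) hXnear
  rw [← hΛ] at hB
  have hfin : Γ * 4 / (4 * Real.pi) * ((Real.sqrt Γ)⁻¹ * (1 / 20)) ≤ Real.sqrt Γ / 60 := by
    obtain ⟨G', hG'⟩ : ∃ G' : ℝ, G' = Real.sqrt Γ := ⟨_, rfl⟩
    have hG'0 : 0 < G' := by rw [hG']; exact hG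
    have hΓG : Γ = G' ^ 2 := by rw [hG', hG2]
    rw [← hG', hΓG]
    rw [show G' ^ 2 * 4 / (4 * Real.pi) * (G'⁻¹ * (1 / 20)) = G' / (20 * Real.pi) by field_simp]
    rw [div_le_div_iff₀ (by positivity) (by norm_num)]
    nlinarith only [hπ, hG'0]
  calc Γ * 4 / (4 * Real.pi) * ((Real.sqrt Γ)⁻¹ * _) ≤ Γ * 4 / (4 * Real.pi) * ((Real.sqrt Γ)⁻¹ * (1 / 20)) :=
        mul_le_mul_of_nonneg_left (mul_le_mul_of_nonneg_left (hB.trans hrem) (inv_pos.2 hG).le) hcΓ.le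
    _ ≤ Real.sqrt Γ / 60 := hfin

end SelectionBoxRJRung

end Summit.NavierStokesRegularity.NavierStokesRegularity.Theorems
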